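import Mathlib
import HarnessLib
import Summits.ValiantsHypothesis.ValiantsHypothesis.Theses.ValuativeGCT
import Literature.Computability.AlgebraicComplexity.OrbitClosureWeights
import Summits.ValiantsHypothesis.ValiantsHypothesis.Theorems.ValuativeGCTValuativeFlipGrowthGap
import Summits.ValiantsHypothesis.ValiantsHypothesis.Theorems.ValuativeGCTValuativeFlipStabInvLeExplicit
import Summits.ValiantsHypothesis.ValiantsHypothesis.Theorems.ValuativeGCTHeadFlipFourRowBridge
import Summits.ValiantsHypothesis.ValiantsHypothesis.Theorems.ValuativeGCTValuativeFlipCyclicPencilCertificate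
import Summits.ValiantsHypothesis.ValiantsHypothesis.Theorems.ValuativeGCTValuativeFlipFourRowHilbertLowerBound
import Summits.ValiantsHypothesis.ValiantsHypothesis.Theorems.ValuativeGCTValuativeFlipFourRowSliceBound
import Summits.ValiantsHypothesis.ValiantsHypothesis.Theorems.ValuativeGCTValuativeFlipTailSuffices
import Summits.ValiantsHypothesis.ValiantsHypothesis.Theorems.ValuativeGCTHeadFlipHolds

/-!
# AUDIT of line `four-row-count` (crux `ValuativeGCT.ValuativeFlip`, stmt-ValiantsHypothesis-12624)

Wall-breaker k6 gen1 (axis: audit-and-glue) on stub `stub_fourRowBridge`,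
seat prover-wallb-stmt-ValiantsHypothesis-12624-stub_fourRowBridge-6-0, 2026-08-16.

This file is the registered skeleton `Cruxes/ValuativeFlip/Lines/four_row_count.lean`
(sha256 b4a1d8c8…72d5) with
* every HEAD stub (`stub_fourRowSliceBound`, `stub_fourRowPencilRank`, `stub_fourRowHilbertLowerBound`,
  `stub_fourRowBridge`) restated VERBATIM and closed IN TERM MODE by a declaration that is already
  accepted in the tree (so each registered signature is closed by name, no tactic glue needed);
* the TAIL stub `stub_tailFlip` shown to be LITERALLY the route decl `ValuativeGCT.TailFlip` (`Iff.rfl`);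
* the skeleton's glue (`headCensus_of`, `headFlipBody_of`, `ValuativeFlip_of`) replayed on the landed
  stubs, with the tail as the only hypothesis; and the landed equivalence `TailFlip ↔ ValuativeFlip`.

Check result expected and obtained: rc 0, 0 sorries, axioms ⊆ {propext, Classical.choice, Quot.sound}.
Conclusion of the audit: NO lemma is missing between the landed halves of the bridge; the line is closed
modulo `stub_tailFlip = TailFlip` (open problem, `↔ ValuativeFlip`).  Evidence file only (every theorem
here restates a landed declaration; landing it would bounce `dedup.landed`, cf. p119993).
-/

set_option linter.dupNamespace false
set_option maxHeartbeats 800000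

namespace Summit.ValiantsHypothesis.ValiantsHypothesis.Cruxes.ValuativeFlip.FourRowCountAudit

open MvPolynomial
open scoped BigOperators Matrix
open Literature.NumberTheory.DiophantineGeometry
open Literature.Computability.AlgebraicComplexity
open Summit.ValiantsHypothesis.ValiantsHypothesis.Theorems.ValuativeFlip

noncomputable section

/-! ## The registered stubs, verbatim; the four head stubs closed by landed declarations (term mode) -/

/-- **stub_fourRowSliceBound** (det side, size M; four-row analogue of the landed B1 `stub_sliceBound`).
Polynomial functions of the last four rows `R₁..R₄ ∈ Mat_m` of `A ∈ End W` (row slots `j` with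
`m² ≤ idx(j) + 4`) that are invariant under the row-wise unimodular sandwich action `R ↦ P R Q`
(`det P = det Q = 1`) restrict INJECTIVELY to the slice `{R₁ = a·1, R₂ diagonal, R₃, R₄ arbitrary}`
(`SL_m × SL_m · slice` is Zariski dense in `Mat_m⁴`: normalise `R₁` to a scalar, then diagonalise
`R₁⁻¹R₂` by conjugation), a linear space of dimension `2m² + m + 1`; so the degree-`D` piece has
dimension at most the number of monomials of degree `D` in `2m² + m + 1` variables `≤ (D+1)^(2m²+m)`.
This is the Krull-dimension count `dim ℂ[Mat_m⁴]^{SL×SL} = 4m² - (2m² - 2) = 2m² + 2` made effective.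
[BLMW 2011 §5.2; Theorems/ValuativeGCTValuativeFlipSliceBound.lean (B1); folklore] -/
theorem audit_stub_fourRowSliceBound :
    ∀ (m : ℕ), 2 ≤ m → ∀ D : ℕ,
      Module.finrank ℂ ↥(MvPolynomial.homogeneousSubmodule (MatIdx m × MatIdx m) ℂ (D) ⊓
        (⨅ (P : Matrix (Fin m) (Fin m) ℂ) (Q : Matrix (Fin m) (Fin m) ℂ) (_ : P.det = 1) (_ : Q.det = 1), LinearMap.ker ((MvPolynomial.aeval fun p : MatIdx m × MatIdx m => ∑ l : MatIdx m, (P (ofLex p.2).1 (ofLex l).1 * Q (ofLex l).2 (ofLex p.2).2) • (MvPolynomial.X (p.1, l) : MvPolynomial (MatIdx m × MatIdx m) ℂ)).toLinearMap - (LinearMap.id : MvPolynomial (MatIdx m × MatIdx m) ℂ →ₗ[ℂ] MvPolynomial (MatIdx m × MatIdx m) ℂ))) ⊓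
        Subalgebra.toSubmodule (MvPolynomial.supported ℂ {p : MatIdx m × MatIdx m | m * m ≤ (((matIdxEquiv m).symm p.1 : Fin (m * m)) : ℕ) + 4})) ≤ (D + 1) ^ (2 * m ^ 2 + m) :=
  -- landed: Theorems/ValuativeGCTValuativeFlipFourRowSliceBound.lean (k15 gen0, p112540)
  Summit.ValiantsHypothesis.ValiantsHypothesis.Theorems.ValuativeFlip.stub_fourRowSliceBound

/-- **stub_fourRowPencilRank** (per side, the COMBINATORIAL HEART, size L).  For all large `n` and
every `n ≤ m ≤ (6/5)·n` there is `g ∈ GL_{m²}` such that the four-row tangent span of `g · X₀₀^{m-n} per_n`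
— the span of `X_a · (∂_b (g·pp))|_{four kept variables}`, `a` kept, `b` arbitrary — has dimension
`≥ 2m² + m + 2`.  Choosing `g` so that `(g·pp)|₄ = ℓ(y)^{m-n} per_n(M(y))` for a four-variable
linear pencil `M(y) = y₁A₁ + y₂A₂ + y₃A₃ + y₄A₄`, the span is
`ℓ^{m-n-1}·(ℓ·span{y_t · Per_{ij}(M(y))} + span{y_t · per(M(y))})` (permanental minors `Per_{ij}`), of
dimension `s(n) + 3` where `s(n) = dim span{y_t Per_{ij}(M)}`; for a generic pencil
`s(n) = min(C(n+3,3), 4n² - 2n + 2)` (the `2n - 2` deficit is per's torus stabiliser; exact numerics,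
strategist folder `compute/`: k = 5,6 non-dominant cases exact, k = 4 n ≤ 10 dominant; the cyclic 4-band with integer
weights attains it; kit job j018409 runs n = 12..19, k = 4), and `2m²+m+2 ≤ s(n)+3` holds
for `m ≤ 1.2 n`, `n ≥ 11`.  TO PROVE: exhibit an explicit pencil (e.g. four weighted permutation
matrices of a 4-regular bipartite graph of large girth, or generic diagonal weights on a banded
pattern) and certify `≥ 2m²+m+2` independent products by a unique-leading-monomial / unique-
transversal argument (cf. the proof of B2 `stub_tangentRank`, `x_a ∂_b per_n` independent for `a ≠ b`).
Why plausibly true: the only linear relations among the `4n²` products are the `2n-1` Laplace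
expansions (rows/columns) of `per(M)`; the determinant's extra `n² - n` adjugate relations
`M·adj(M) = det·1` are exactly what the permanent lacks.  [new; Marcus–May 1962 (Stab per);
this crux's B2 `Theorems/ValuativeGCTValuativeFlipTangentRank.lean`] -/
theorem audit_stub_fourRowPencilRank :
    ∃ n₀ : ℕ, ∀ n ≥ n₀, ∀ (m : ℕ) [NeZero m], n ≤ m → 5 * m ≤ 6 * n →
      ∃ g : GL (MatIdx m) ℂ, 2 * m ^ 2 + m + 2 ≤ Module.finrank ℂ ↥(Submodule.span ℂ (Set.range fun ab : {a : MatIdx m // m * m ≤ (((matIdxEquiv m).symm a : Fin (m * m)) : ℕ) + 4} × MatIdx m => (MvPolynomial.X ab.1.1 : MvPolynomial (MatIdx m) ℂ) * MvPolynomial.aeval (fun i : MatIdx m => if m * m ≤ (((matIdxEquiv m).symm i : Fin (m * m)) : ℕ) + 4 then (MvPolynomial.X i : MvPolynomial (MatIdx m) ℂ) else 0) (MvPolynomial.pderiv ab.2 (linSubst (MatIdx m) ℂ ((g : GL (MatIdx m) ℂ) : Matrix (MatIdx m) (MatIdx m) ℂ) (paddedPerFormLex ℂ n m))))) :=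
  -- landed: Theorems/ValuativeGCTValuativeFlipCyclicPencilCertificate.lean (k9 gen1 a2)
  Summit.ValiantsHypothesis.ValiantsHypothesis.Theorems.ValuativeFlip.stub_fourRowPencilRank

/-- **stub_fourRowHilbertLowerBound** (per side, size M–L; four-row analogue of the landed B3
`stub_hilbertLowerBound`, base point moved from `A = 1` to `A = g`).  If the four-row tangent span of
`g · pp` has dimension `≥ N + 1`, then the degree-`δ` piece of the FOUR-ROW orbit image
`genericOrbitMap pp m (polynomials in the coefficients X_d with d supported on the four kept
variables)` — which is the degree-`δ` coordinate ring of `P_{m,4} = closure{(A·pp)|₄} ⊂ Sym^m ℂ⁴`,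
a cone of dimension `≥ N + 1` — has dimension `≥ C(δ+N, N)`.  Proof route: `genericOrbitMap (g·pp) =
(Y ↦ Y·g) ∘ genericOrbitMap pp` (right multiplication preserves row slots and degrees), then initial
forms at `Y = 1` exactly as in B3: monomials of degree `δ` in `N + 1` coefficient functionals whose
differentials are independent on the tangent span have independent lowest-order terms.
[Mulmuley–Sohoni 2001 §4; Theorems/ValuativeGCTValuativeFlipHilbertLowerBound.lean (B3); folklore] -/
theorem audit_stub_fourRowHilbertLowerBound :
    ∀ (n m : ℕ) [NeZero m], n ≤ m → ∀ (g : GL (MatIdx m) ℂ) (N δ : ℕ),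
      N + 1 ≤ Module.finrank ℂ ↥(Submodule.span ℂ (Set.range fun ab : {a : MatIdx m // m * m ≤ (((matIdxEquiv m).symm a : Fin (m * m)) : ℕ) + 4} × MatIdx m => (MvPolynomial.X ab.1.1 : MvPolynomial (MatIdx m) ℂ) * MvPolynomial.aeval (fun i : MatIdx m => if m * m ≤ (((matIdxEquiv m).symm i : Fin (m * m)) : ℕ) + 4 then (MvPolynomial.X i : MvPolynomial (MatIdx m) ℂ) else 0) (MvPolynomial.pderiv ab.2 (linSubst (MatIdx m) ℂ ((g : GL (MatIdx m) ℂ) : Matrix (MatIdx m) (MatIdx m) ℂ) (paddedPerFormLex ℂ n m))))) →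
      Nat.choose (δ + N) N ≤ Module.finrank ℂ ↥(((MvPolynomial.homogeneousSubmodule (DegIdx (MatIdx m) m) ℂ δ ⊓ Subalgebra.toSubmodule (MvPolynomial.supported ℂ {d : DegIdx (MatIdx m) m | ∀ i : MatIdx m, ¬ (m * m ≤ (((matIdxEquiv m).symm i : Fin (m * m)) : ℕ) + 4) → d.1 i = 0})).map (genericOrbitMap (paddedPerFormLex ℂ n m) m).toLinearMap)) :=
  -- landed: Theorems/ValuativeGCTValuativeFlipFourRowHilbertLowerBound.lean (k15)
  Summit.ValiantsHypothesis.ValiantsHypothesis.Theorems.ValuativeFlip.stub_fourRowHilbertLowerBound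

/-- **stub_fourRowBridge** (representation theory, size L; four-row analogue of the landed B6
`stub_bottomBridge`, now `GL₄`-equivariant instead of `GL(W)`-equivariant).  Both four-row modules are
stable under the block `GL₄ ⊂ GL(W)` acting by left translation on the four kept row slots (and under
the upper-triangular Borel of `GL(W)`, which acts on functions of the last four rows through its
lower-right `4 × 4` block): the det-side `Hom_{mδ} ⊓ SAND ⊓ ROWS₄` and the per-side four-row image
(`≅ ℂ[P_{m,4}]_δ`).  A dimension gap gives, by the landed counting lemma B4 `stub_multiplicityCount`
for rational `GL₄`-modules, a `GL₄`-weight `χ₄` with `hwMult(det side) < hwMult(per side)`; a nonzero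
highest-weight vector in the degree-`δ` piece pins `χ₄` to `λ*|₄` for a partition `λ ⊢ mδ` with
`ℓ(λ) ≤ 4` (degree/size bookkeeping as in `sb_bridge`); the per-side `GL₄`-highest-weight vectors of
weight `λ*|₄` inside the four-row image are `B`-semi-invariants of weight `λ*` in `ℂ[Δ_m(pp)]_δ`
(`hwMult ≤ orbitMultiplicity`, KL 2014 Prop. 1.12 "inheritance"); and on the det side every
`B`-semi-invariant of weight `λ*` (`ℓ(λ) ≤ 4`: torus weight zero on all other row slots) in
`Hom ⊓ SAND` is a function of the four kept rows, i.e. lies in the `χ₄`-highest-weight space of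
`Hom ⊓ SAND ⊓ ROWS₄`.  Hence `dim(Hom_{mδ} ⊓ SAND ⊓ HWSP(λ*)) < mult_{λ*} ℂ[Δ_m(X₀₀^{m-n} per_n)]`.
[BLMW 2011 §5.2; Goodman–Wallach §3.2, §4.1; arXiv:1204.4693 Prop. 1.12;
Theorems/ValuativeGCTValuativeFlipBottomBridge.lean (B6), …MultiplicityCount.lean (B4)] -/
theorem audit_stub_fourRowBridge :
    ∀ (n m : ℕ) [NeZero m] (δ : ℕ), n ≤ m → 2 ≤ m →
      Module.finrank ℂ ↥(MvPolynomial.homogeneousSubmodule (MatIdx m × MatIdx m) ℂ (m * δ) ⊓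
        (⨅ (P : Matrix (Fin m) (Fin m) ℂ) (Q : Matrix (Fin m) (Fin m) ℂ) (_ : P.det = 1) (_ : Q.det = 1), LinearMap.ker ((MvPolynomial.aeval fun p : MatIdx m × MatIdx m => ∑ l : MatIdx m, (P (ofLex p.2).1 (ofLex l).1 * Q (ofLex l).2 (ofLex p.2).2) • (MvPolynomial.X (p.1, l) : MvPolynomial (MatIdx m × MatIdx m) ℂ)).toLinearMap - (LinearMap.id : MvPolynomial (MatIdx m × MatIdx m) ℂ →ₗ[ℂ] MvPolynomial (MatIdx m × MatIdx m) ℂ))) ⊓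
        Subalgebra.toSubmodule (MvPolynomial.supported ℂ {p : MatIdx m × MatIdx m | m * m ≤ (((matIdxEquiv m).symm p.1 : Fin (m * m)) : ℕ) + 4})) <
      Module.finrank ℂ ↥(((MvPolynomial.homogeneousSubmodule (DegIdx (MatIdx m) m) ℂ δ ⊓ Subalgebra.toSubmodule (MvPolynomial.supported ℂ {d : DegIdx (MatIdx m) m | ∀ i : MatIdx m, ¬ (m * m ≤ (((matIdxEquiv m).symm i : Fin (m * m)) : ℕ) + 4) → d.1 i = 0})).map (genericOrbitMap (paddedPerFormLex ℂ n m) m).toLinearMap)) →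
      ∃ lam : Nat.Partition (m * δ), lam.parts.card ≤ 4 ∧
        Module.finrank ℂ ↥(MvPolynomial.homogeneousSubmodule (MatIdx m × MatIdx m) ℂ (m * δ) ⊓
          (⨅ (P : Matrix (Fin m) (Fin m) ℂ) (Q : Matrix (Fin m) (Fin m) ℂ) (_ : P.det = 1) (_ : Q.det = 1), LinearMap.ker ((MvPolynomial.aeval fun p : MatIdx m × MatIdx m => ∑ l : MatIdx m, (P (ofLex p.2).1 (ofLex l).1 * Q (ofLex l).2 (ofLex p.2).2) • (MvPolynomial.X (p.1, l) : MvPolynomial (MatIdx m × MatIdx m) ℂ)).toLinearMap - (LinearMap.id : MvPolynomial (MatIdx m × MatIdx m) ℂ →ₗ[ℂ] MvPolynomial (MatIdx m × MatIdx m) ℂ))) ⊓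
          (⨅ (g : Matrix.GeneralLinearGroup (MatIdx m) ℂ) (_ : IsUpperTriangular g), LinearMap.ker ((MvPolynomial.aeval fun p : MatIdx m × MatIdx m => ∑ l : MatIdx m, ((g⁻¹ : Matrix.GeneralLinearGroup (MatIdx m) ℂ) : Matrix (MatIdx m) (MatIdx m) ℂ) p.1 l • (MvPolynomial.X (l, p.2) : MvPolynomial (MatIdx m × MatIdx m) ℂ)).toLinearMap - weightChar ((Weight.dualOfPartition (m * m) lam).toMatIdx : Weight (MatIdx m)) g • (LinearMap.id : MvPolynomial (MatIdx m × MatIdx m) ℂ →ₗ[ℂ] MvPolynomial (MatIdx m × MatIdx m) ℂ)))) <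
        orbitMultiplicity ℂ (paddedPerFormLex ℂ n m) m ((Weight.dualOfPartition (m * m) lam).toMatIdx : Weight (MatIdx m)) :=
  -- landed: Theorems/ValuativeGCTHeadFlipFourRowBridge.lean (child crux HeadFlip, stmt-15535, 18:24Z)
  Summit.ValiantsHypothesis.ValiantsHypothesis.Theorems.HeadFlip.stub_fourRowBridge

/-- **stub_tailFlip** — THE RESIDUAL CRUX (open; = the strategist's sub-crux `TailFlip` of the split
`ValuativeFlip = HeadFlip ∧ TailFlip`, `Cruxes/ValuativeFlip/STRATEGY-CENSUS.md` §Decomposition).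
For every slope `a/b > 1` and every `c`, eventually in `n`, every window position ABOVE the linear
head, `(a/b)·n < m ≤ 2^((log₂ n + c)^c)`, carries a valuative flip.  The four-row count of this line
provably stops at `m < √2·n` (det side `(k-2)m² + 2` beats per side `k n² - 2n + k + 1` in EVERY number
`k` of rows once `m² > n²·k/(k-2)`), so this stub needs isotypic (not total) information: a per-side
multiplicity lower bound on Kadish–Landsberg shapes of growing length — the open multiplicity-
obstruction problem of the Mulmuley–Sohoni programme (sandwich `GctKroneckerFlip ⇒ · ⇒ GctMultFlip`).
Honest label: OPEN, conjecture-grade.  [Mulmuley–Sohoni 2001/2008; BLMW 2011 §5; arXiv:1604.06431;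
Bläser–Ikenmeyer 2025 §12.4; this crux's LeadCensus-c1..c3] -/
theorem audit_stub_tailFlip_iff :
    (∀ a b : ℕ, b < a → ∀ c : ℕ, ∃ n₀ : ℕ, ∀ n ≥ n₀, ∀ (m : ℕ) [NeZero m], a * n < b * m → m ≤ 2 ^ ((Nat.log 2 n + c) ^ c) →
      ∃ (U : Submodule ℂ (MatIdx m → ℂ)) (r δ : ℕ) (lam : Nat.Partition (m * δ)), (∀ u ∈ U, (Matrix.of fun a b : Fin m => u (toLex (a, b))).rank ≤ r) ∧ lam.parts.card ≤ m * m ∧ (let χ : Weight (MatIdx m) := (Weight.dualOfPartition (m * m) lam).toMatIdx; let T : Submodule ℂ (MvPolynomial (MatIdx m × MatIdx m) ℂ) := MvPolynomial.homogeneousSubmodule (MatIdx m × MatIdx m) ℂ (m * δ) ⊓ ((MvPolynomial.vanishingIdeal ℂ {p : MatIdx m × MatIdx m → ℂ | ∀ j : MatIdx m, (fun i => p (j, i)) ∈ U}) ^ (δ * (m - r))).restrictScalars ℂ ⊓ (⨅ (M : Matrix (MatIdx m) (MatIdx m) ℂ) (_ : linSubst (MatIdx m) ℂ M (detFormLex ℂ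 m) = detFormLex ℂ m), LinearMap.ker ((MvPolynomial.aeval (R := ℂ) fun p : MatIdx m × MatIdx m => ∑ l : MatIdx m, M l p.2 • MvPolynomial.X (p.1, l)).toLinearMap - LinearMap.id (R := ℂ) (M := MvPolynomial (MatIdx m × MatIdx m) ℂ))) ⊓ (⨅ (g : Matrix.GeneralLinearGroup (MatIdx m) ℂ) (_ : IsUpperTriangular g), LinearMap.ker ((MvPolynomial.aeval (R := ℂ) fun p : MatIdx m × MatIdx m => ∑ l : MatIdx m, ((g⁻¹ : Matrix.GeneralLinearGroup (MatIdx m) ℂ) : Matrix (MatIdx m) (MatIdx m) ℂ) p.1 l • MvPolynomial.X (l, p.2)).toLinearMap - weightChar χ g • LinearMap.id (R := ℂ) (M := MvPolynomial (MatIdx m × MatIdx m) ℂ))); Module.finrank ℂ ↥T < orbitMultiplicity ℂ (paddedPerFormLex ℂ n m) m χ)) ↔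
      Summit.ValiantsHypothesis.ValiantsHypothesis.Theses.ValuativeGCT.TailFlip :=
  Iff.rfl


/-! ## Glue (sorry-free): the linear head from stubs 1–4, then the crux from head + tail -/

/-- The four-row census at one window position of the head: from the four stubs, for `n ≤ m ≤ 1.2 n`
(`n` large, `m ≥ 2`) some `λ ⊢ mδ` with at most four rows has
`dim(Hom_{mδ} ⊓ SAND ⊓ HWSP(λ*)) < mult_{λ*} ℂ[Δ_m(X₀₀^{m-n} per_n)]` — a symmetric-Kronecker-type flip
ABOVE the bottom of the window.  Sorry-free over the stubs (growth gap = landed B5). [this line] -/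
theorem audit_headCensus_of (hS1 : ∀ (m : ℕ), 2 ≤ m → ∀ D : ℕ,
      Module.finrank ℂ ↥(MvPolynomial.homogeneousSubmodule (MatIdx m × MatIdx m) ℂ (D) ⊓
        (⨅ (P : Matrix (Fin m) (Fin m) ℂ) (Q : Matrix (Fin m) (Fin m) ℂ) (_ : P.det = 1) (_ : Q.det = 1), LinearMap.ker ((MvPolynomial.aeval fun p : MatIdx m × MatIdx m => ∑ l : MatIdx m, (P (ofLex p.2).1 (ofLex l).1 * Q (ofLex l).2 (ofLex p.2).2) • (MvPolynomial.X (p.1, l) : MvPolynomial (MatIdx m × MatIdx m) ℂ)).toLinearMap - (LinearMap.id : MvPolynomial (MatIdx m × MatIdx m) ℂ →ₗ[ℂ] MvPolynomial (MatIdx m × MatIdx m) ℂ))) ⊓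
        Subalgebra.toSubmodule (MvPolynomial.supported ℂ {p : MatIdx m × MatIdx m | m * m ≤ (((matIdxEquiv m).symm p.1 : Fin (m * m)) : ℕ) + 4})) ≤ (D + 1) ^ (2 * m ^ 2 + m))
    (hS3 : ∀ (n m : ℕ) [NeZero m], n ≤ m → ∀ (g : GL (MatIdx m) ℂ) (N δ : ℕ),
      N + 1 ≤ Module.finrank ℂ ↥(Submodule.span ℂ (Set.range fun ab : {a : MatIdx m // m * m ≤ (((matIdxEquiv m).symm a : Fin (m * m)) : ℕ) + 4} × MatIdx m => (MvPolynomial.X ab.1.1 : MvPolynomial (MatIdx m) ℂ) * MvPolynomial.aeval (fun i : MatIdx m => if m * m ≤ (((matIdxEquiv m).symm i : Fin (m * m)) : ℕ) + 4 then (MvPolynomial.X i : MvPolynomial (MatIdx m) ℂ) else 0) (MvPolynomial.pderiv ab.2 (linSubst (MatIdx m) ℂ ((g : GL (MatIdx m) ℂ) : Matrix (MatIdx m) (MatIdx m) ℂ) (paddedPerFormLex ℂ n m))))) →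
      Nat.choose (δ + N) N ≤ Module.finrank ℂ ↥(((MvPolynomial.homogeneousSubmodule (DegIdx (MatIdx m) m) ℂ δ ⊓ Subalgebra.toSubmodule (MvPolynomial.supported ℂ {d : DegIdx (MatIdx m) m | ∀ i : MatIdx m, ¬ (m * m ≤ (((matIdxEquiv m).symm i : Fin (m * m)) : ℕ) + 4) → d.1 i = 0})).map (genericOrbitMap (paddedPerFormLex ℂ n m) m).toLinearMap)))
    (hS4 : ∀ (n m : ℕ) [NeZero m] (δ : ℕ), n ≤ m → 2 ≤ m →
      Module.finrank ℂ ↥(MvPolynomial.homogeneousSubmodule (MatIdx m × MatIdx m) ℂ (m * δ) ⊓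
        (⨅ (P : Matrix (Fin m) (Fin m) ℂ) (Q : Matrix (Fin m) (Fin m) ℂ) (_ : P.det = 1) (_ : Q.det = 1), LinearMap.ker ((MvPolynomial.aeval fun p : MatIdx m × MatIdx m => ∑ l : MatIdx m, (P (ofLex p.2).1 (ofLex l).1 * Q (ofLex l).2 (ofLex p.2).2) • (MvPolynomial.X (p.1, l) : MvPolynomial (MatIdx m × MatIdx m) ℂ)).toLinearMap - (LinearMap.id : MvPolynomial (MatIdx m × MatIdx m) ℂ →ₗ[ℂ] MvPolynomial (MatIdx m × MatIdx m) ℂ))) ⊓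
        Subalgebra.toSubmodule (MvPolynomial.supported ℂ {p : MatIdx m × MatIdx m | m * m ≤ (((matIdxEquiv m).symm p.1 : Fin (m * m)) : ℕ) + 4})) <
      Module.finrank ℂ ↥(((MvPolynomial.homogeneousSubmodule (DegIdx (MatIdx m) m) ℂ δ ⊓ Subalgebra.toSubmodule (MvPolynomial.supported ℂ {d : DegIdx (MatIdx m) m | ∀ i : MatIdx m, ¬ (m * m ≤ (((matIdxEquiv m).symm i : Fin (m * m)) : ℕ) + 4) → d.1 i = 0})).map (genericOrbitMap (paddedPerFormLex ℂ n m) m).toLinearMap)) →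
      ∃ lam : Nat.Partition (m * δ), lam.parts.card ≤ 4 ∧
        Module.finrank ℂ ↥(MvPolynomial.homogeneousSubmodule (MatIdx m × MatIdx m) ℂ (m * δ) ⊓
          (⨅ (P : Matrix (Fin m) (Fin m) ℂ) (Q : Matrix (Fin m) (Fin m) ℂ) (_ : P.det = 1) (_ : Q.det = 1), LinearMap.ker ((MvPolynomial.aeval fun p : MatIdx m × MatIdx m => ∑ l : MatIdx m, (P (ofLex p.2).1 (ofLex l).1 * Q (ofLex l).2 (ofLex p.2).2) • (MvPolynomial.X (p.1, l) : MvPolynomial (MatIdx m × MatIdx m) ℂ)).toLinearMap - (LinearMap.id : MvPolynomial (MatIdx m × MatIdx m) ℂ →ₗ[ℂ] MvPolynomial (MatIdx m × MatIdx m) ℂ))) ⊓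
          (⨅ (g : Matrix.GeneralLinearGroup (MatIdx m) ℂ) (_ : IsUpperTriangular g), LinearMap.ker ((MvPolynomial.aeval fun p : MatIdx m × MatIdx m => ∑ l : MatIdx m, ((g⁻¹ : Matrix.GeneralLinearGroup (MatIdx m) ℂ) : Matrix (MatIdx m) (MatIdx m) ℂ) p.1 l • (MvPolynomial.X (l, p.2) : MvPolynomial (MatIdx m × MatIdx m) ℂ)).toLinearMap - weightChar ((Weight.dualOfPartition (m * m) lam).toMatIdx : Weight (MatIdx m)) g • (LinearMap.id : MvPolynomial (MatIdx m × MatIdx m) ℂ →ₗ[ℂ] MvPolynomial (MatIdx m × MatIdx m) ℂ)))) <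
        orbitMultiplicity ℂ (paddedPerFormLex ℂ n m) m ((Weight.dualOfPartition (m * m) lam).toMatIdx : Weight (MatIdx m)))
    (n m : ℕ) [NeZero m] (hnm : n ≤ m) (hm2 : 2 ≤ m) (g : GL (MatIdx m) ℂ)
    (hg : 2 * m ^ 2 + m + 2 ≤ Module.finrank ℂ ↥(Submodule.span ℂ (Set.range fun ab : {a : MatIdx m // m * m ≤ (((matIdxEquiv m).symm a : Fin (m * m)) : ℕ) + 4} × MatIdx m => (MvPolynomial.X ab.1.1 : MvPolynomial (MatIdx m) ℂ) * MvPolynomial.aeval (fun i : MatIdx m => if m * m ≤ (((matIdxEquiv m).symm i : Fin (m * m)) : ℕ) + 4 then (MvPolynomial.X i : MvPolynomial (MatIdx m) ℂ) else 0) (MvPolynomial.pderiv ab.2 (linSubst (MatIdx m) ℂ ((g : GL (MatIdx m) ℂ) : Matrix (MatIdx m) (MatIdx m) ℂ) (paddedPerFormLex ℂ n m)))))) :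
    ∃ (δ : ℕ) (lam : Nat.Partition (m * δ)), lam.parts.card ≤ 4 ∧
        Module.finrank ℂ ↥(MvPolynomial.homogeneousSubmodule (MatIdx m × MatIdx m) ℂ (m * δ) ⊓
          (⨅ (P : Matrix (Fin m) (Fin m) ℂ) (Q : Matrix (Fin m) (Fin m) ℂ) (_ : P.det = 1) (_ : Q.det = 1), LinearMap.ker ((MvPolynomial.aeval fun p : MatIdx m × MatIdx m => ∑ l : MatIdx m, (P (ofLex p.2).1 (ofLex l).1 * Q (ofLex l).2 (ofLex p.2).2) • (MvPolynomial.X (p.1, l) : MvPolynomial (MatIdx m × MatIdx m) ℂ)).toLinearMap - (LinearMap.id : MvPolynomial (MatIdx m × MatIdx m) ℂ →ₗ[ℂ] MvPolynomial (MatIdx m × MatIdx m) ℂ))) ⊓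
          (⨅ (g : Matrix.GeneralLinearGroup (MatIdx m) ℂ) (_ : IsUpperTriangular g), LinearMap.ker ((MvPolynomial.aeval fun p : MatIdx m × MatIdx m => ∑ l : MatIdx m, ((g⁻¹ : Matrix.GeneralLinearGroup (MatIdx m) ℂ) : Matrix (MatIdx m) (MatIdx m) ℂ) p.1 l • (MvPolynomial.X (l, p.2) : MvPolynomial (MatIdx m × MatIdx m) ℂ)).toLinearMap - weightChar ((Weight.dualOfPartition (m * m) lam).toMatIdx : Weight (MatIdx m)) g • (LinearMap.id : MvPolynomial (MatIdx m × MatIdx m) ℂ →ₗ[ℂ] MvPolynomial (MatIdx m × MatIdx m) ℂ)))) <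
        orbitMultiplicity ℂ (paddedPerFormLex ℂ n m) m ((Weight.dualOfPartition (m * m) lam).toMatIdx : Weight (MatIdx m)) := by
  have hzN : (2 * m ^ 2 + m) + 1 ≤ 2 * m ^ 2 + m + 1 := le_rfl
  obtain ⟨δ, hδ⟩ := stub_growthGap m (2 * m ^ 2 + m) (2 * m ^ 2 + m + 1) hzN
  have hN : (2 * m ^ 2 + m + 1) + 1 ≤ Module.finrank ℂ ↥(Submodule.span ℂ (Set.range fun ab : {a : MatIdx m // m * m ≤ (((matIdxEquiv m).symm a : Fin (m * m)) : ℕ) + 4} × MatIdx m => (MvPolynomial.X ab.1.1 : MvPolynomial (MatIdx m) ℂ) * MvPolynomial.aeval (fun i : MatIdx m => if m * m ≤ (((matIdxEquiv m).symm i : Fin (m * m)) : ℕ) + 4 then (MvPolynomial.X i : MvPolynomial (MatIdx m) ℂ) else 0) (MvPolynomial.pderiv ab.2 (linSubst (MatIdx m) ℂ ((g : GL (MatIdx m) ℂ) : Matrix (MatIdx m) (MatIdx m) ℂ) (paddedPerFormLex ℂ n m))))) := by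
    have h22 : (2 * m ^ 2 + m + 1) + 1 = 2 * m ^ 2 + m + 2 := by ring
    rw [h22]
    exact hg
  have h3 := hS3 n m hnm g (2 * m ^ 2 + m + 1) δ hN
  have h1 := hS1 m hm2 (m * δ)
  have hgap := lt_of_le_of_lt h1 (lt_of_lt_of_le hδ h3)
  obtain ⟨lam, hcard, hlt⟩ := hS4 n m δ hnm hm2 hgap
  exact ⟨δ, lam, hcard, hlt⟩

/-- **The linear head of the window** (`= HeadFlip` of the strategist's split with slope `6/5`):
for all large `n` and every `n ≤ m ≤ (6/5)·n` the body of the route decl `ValuativeGCT.ValuativeFlip`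
holds (verbatim `let χ`, `let T`), with the no-cut centre `U = ⊥`, `r = 0` (`T_⊥ ≤ Hom ⊓ SAND` by the
landed `stub_stabInv_le_explicit`).  Sorry-free over stubs 1–4. [this line] -/
theorem audit_headFlipBody_of (hS1 : ∀ (m : ℕ), 2 ≤ m → ∀ D : ℕ,
      Module.finrank ℂ ↥(MvPolynomial.homogeneousSubmodule (MatIdx m × MatIdx m) ℂ (D) ⊓
        (⨅ (P : Matrix (Fin m) (Fin m) ℂ) (Q : Matrix (Fin m) (Fin m) ℂ) (_ : P.det = 1) (_ : Q.det = 1), LinearMap.ker ((MvPolynomial.aeval fun p : MatIdx m × MatIdx m => ∑ l : MatIdx m, (P (ofLex p.2).1 (ofLex l).1 * Q (ofLex l).2 (ofLex p.2).2) • (MvPolynomial.X (p.1, l) : MvPolynomial (MatIdx m × MatIdx m) ℂ)).toLinearMap - (LinearMap.id : MvPolynomial (MatIdx m × MatIdx m) ℂ →ₗ[ℂ] MvPolynomial (MatIdx m × MatIdx m) ℂ))) ⊓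
        Subalgebra.toSubmodule (MvPolynomial.supported ℂ {p : MatIdx m × MatIdx m | m * m ≤ (((matIdxEquiv m).symm p.1 : Fin (m * m)) : ℕ) + 4})) ≤ (D + 1) ^ (2 * m ^ 2 + m))
    (hS2 : ∃ n₀ : ℕ, ∀ n ≥ n₀, ∀ (m : ℕ) [NeZero m], n ≤ m → 5 * m ≤ 6 * n →
      ∃ g : GL (MatIdx m) ℂ, 2 * m ^ 2 + m + 2 ≤ Module.finrank ℂ ↥(Submodule.span ℂ (Set.range fun ab : {a : MatIdx m // m * m ≤ (((matIdxEquiv m).symm a : Fin (m * m)) : ℕ) + 4} × MatIdx m => (MvPolynomial.X ab.1.1 : MvPolynomial (MatIdx m) ℂ) * MvPolynomial.aeval (fun i : MatIdx m => if m * m ≤ (((matIdxEquiv m).symm i : Fin (m * m)) : ℕ) + 4 then (MvPolynomial.X i : MvPolynomial (MatIdx m) ℂ) else 0) (MvPolynomial.pderiv ab.2 (linSubst (MatIdx m) ℂ ((g : GL (MatIdx m) ℂ) : Matrix (MatIdx m) (MatIdx m) ℂ) (paddedPerFormLex ℂ n m))))))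
    (hS3 : ∀ (n m : ℕ) [NeZero m], n ≤ m → ∀ (g : GL (MatIdx m) ℂ) (N δ : ℕ),
      N + 1 ≤ Module.finrank ℂ ↥(Submodule.span ℂ (Set.range fun ab : {a : MatIdx m // m * m ≤ (((matIdxEquiv m).symm a : Fin (m * m)) : ℕ) + 4} × MatIdx m => (MvPolynomial.X ab.1.1 : MvPolynomial (MatIdx m) ℂ) * MvPolynomial.aeval (fun i : MatIdx m => if m * m ≤ (((matIdxEquiv m).symm i : Fin (m * m)) : ℕ) + 4 then (MvPolynomial.X i : MvPolynomial (MatIdx m) ℂ) else 0) (MvPolynomial.pderiv ab.2 (linSubst (MatIdx m) ℂ ((g : GL (MatIdx m) ℂ) : Matrix (MatIdx m) (MatIdx m) ℂ) (paddedPerFormLex ℂ n m))))) →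
      Nat.choose (δ + N) N ≤ Module.finrank ℂ ↥(((MvPolynomial.homogeneousSubmodule (DegIdx (MatIdx m) m) ℂ δ ⊓ Subalgebra.toSubmodule (MvPolynomial.supported ℂ {d : DegIdx (MatIdx m) m | ∀ i : MatIdx m, ¬ (m * m ≤ (((matIdxEquiv m).symm i : Fin (m * m)) : ℕ) + 4) → d.1 i = 0})).map (genericOrbitMap (paddedPerFormLex ℂ n m) m).toLinearMap)))
    (hS4 : ∀ (n m : ℕ) [NeZero m] (δ : ℕ), n ≤ m → 2 ≤ m →
      Module.finrank ℂ ↥(MvPolynomial.homogeneousSubmodule (MatIdx m × MatIdx m) ℂ (m * δ) ⊓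
        (⨅ (P : Matrix (Fin m) (Fin m) ℂ) (Q : Matrix (Fin m) (Fin m) ℂ) (_ : P.det = 1) (_ : Q.det = 1), LinearMap.ker ((MvPolynomial.aeval fun p : MatIdx m × MatIdx m => ∑ l : MatIdx m, (P (ofLex p.2).1 (ofLex l).1 * Q (ofLex l).2 (ofLex p.2).2) • (MvPolynomial.X (p.1, l) : MvPolynomial (MatIdx m × MatIdx m) ℂ)).toLinearMap - (LinearMap.id : MvPolynomial (MatIdx m × MatIdx m) ℂ →ₗ[ℂ] MvPolynomial (MatIdx m × MatIdx m) ℂ))) ⊓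
        Subalgebra.toSubmodule (MvPolynomial.supported ℂ {p : MatIdx m × MatIdx m | m * m ≤ (((matIdxEquiv m).symm p.1 : Fin (m * m)) : ℕ) + 4})) <
      Module.finrank ℂ ↥(((MvPolynomial.homogeneousSubmodule (DegIdx (MatIdx m) m) ℂ δ ⊓ Subalgebra.toSubmodule (MvPolynomial.supported ℂ {d : DegIdx (MatIdx m) m | ∀ i : MatIdx m, ¬ (m * m ≤ (((matIdxEquiv m).symm i : Fin (m * m)) : ℕ) + 4) → d.1 i = 0})).map (genericOrbitMap (paddedPerFormLex ℂ n m) m).toLinearMap)) →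
      ∃ lam : Nat.Partition (m * δ), lam.parts.card ≤ 4 ∧
        Module.finrank ℂ ↥(MvPolynomial.homogeneousSubmodule (MatIdx m × MatIdx m) ℂ (m * δ) ⊓
          (⨅ (P : Matrix (Fin m) (Fin m) ℂ) (Q : Matrix (Fin m) (Fin m) ℂ) (_ : P.det = 1) (_ : Q.det = 1), LinearMap.ker ((MvPolynomial.aeval fun p : MatIdx m × MatIdx m => ∑ l : MatIdx m, (P (ofLex p.2).1 (ofLex l).1 * Q (ofLex l).2 (ofLex p.2).2) • (MvPolynomial.X (p.1, l) : MvPolynomial (MatIdx m × MatIdx m) ℂ)).toLinearMap - (LinearMap.id : MvPolynomial (MatIdx m × MatIdx m) ℂ →ₗ[ℂ] MvPolynomial (MatIdx m × MatIdx m) ℂ))) ⊓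
          (⨅ (g : Matrix.GeneralLinearGroup (MatIdx m) ℂ) (_ : IsUpperTriangular g), LinearMap.ker ((MvPolynomial.aeval fun p : MatIdx m × MatIdx m => ∑ l : MatIdx m, ((g⁻¹ : Matrix.GeneralLinearGroup (MatIdx m) ℂ) : Matrix (MatIdx m) (MatIdx m) ℂ) p.1 l • (MvPolynomial.X (l, p.2) : MvPolynomial (MatIdx m × MatIdx m) ℂ)).toLinearMap - weightChar ((Weight.dualOfPartition (m * m) lam).toMatIdx : Weight (MatIdx m)) g • (LinearMap.id : MvPolynomial (MatIdx m × MatIdx m) ℂ →ₗ[ℂ] MvPolynomial (MatIdx m × MatIdx m) ℂ)))) <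
        orbitMultiplicity ℂ (paddedPerFormLex ℂ n m) m ((Weight.dualOfPartition (m * m) lam).toMatIdx : Weight (MatIdx m))) :
    ∃ n₀ : ℕ, ∀ n ≥ n₀, ∀ (m : ℕ) [NeZero m], n ≤ m → 5 * m ≤ 6 * n →
      ∃ (U : Submodule ℂ (MatIdx m → ℂ)) (r δ : ℕ) (lam : Nat.Partition (m * δ)), (∀ u ∈ U, (Matrix.of fun a b : Fin m => u (toLex (a, b))).rank ≤ r) ∧ lam.parts.card ≤ m * m ∧ (let χ : Weight (MatIdx m) := (Weight.dualOfPartition (m * m) lam).toMatIdx; let T : Submodule ℂ (MvPolynomial (MatIdx m × MatIdx m) ℂ) := MvPolynomial.homogeneousSubmodule (MatIdx m × MatIdx m) ℂ (m * δ) ⊓ ((MvPolynomial.vanishingIdeal ℂ {p : MatIdx m × MatIdx m → ℂ | ∀ j : MatIdx m, (fun i => p (j, i)) ∈ U}) ^ (δ * (m - r))).restrictScalars ℂ ⊓ (⨅ (M : Matrix (MatIdx m) (MatIdx m) ℂ) (_ : linSubst (MatIdx m) ℂ M (detFormLex ℂ m) = detFormLex ℂ m), LinearMap.ker ((MvPolynomial.aeval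 (R := ℂ) fun p : MatIdx m × MatIdx m => ∑ l : MatIdx m, M l p.2 • MvPolynomial.X (p.1, l)).toLinearMap - LinearMap.id (R := ℂ) (M := MvPolynomial (MatIdx m × MatIdx m) ℂ))) ⊓ (⨅ (g : Matrix.GeneralLinearGroup (MatIdx m) ℂ) (_ : IsUpperTriangular g), LinearMap.ker ((MvPolynomial.aeval (R := ℂ) fun p : MatIdx m × MatIdx m => ∑ l : MatIdx m, ((g⁻¹ : Matrix.GeneralLinearGroup (MatIdx m) ℂ) : Matrix (MatIdx m) (MatIdx m) ℂ) p.1 l • MvPolynomial.X (l, p.2)).toLinearMap - weightChar χ g • LinearMap.id (R := ℂ) (M := MvPolynomial (MatIdx m × MatIdx m) ℂ))); Module.finrank ℂ ↥T < orbitMultiplicity ℂ (paddedPerFormLex ℂ n m) m χ) := by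
  obtain ⟨n₁, hn₁⟩ := hS2
  refine ⟨max n₁ 3, fun n hn m _ hnm h56 => ?_⟩
  have hn1 : n₁ ≤ n := le_of_max_le_left hn
  have hn3 : 3 ≤ n := le_of_max_le_right hn
  have hm2 : 2 ≤ m := by omega
  obtain ⟨g, hg⟩ := hn₁ n hn1 m hnm h56
  obtain ⟨δ, lam, hcard, hlt⟩ := audit_headCensus_of hS1 hS3 hS4 n m hnm hm2 g hg
  refine ⟨⊥, 0, δ, lam, ?_, ?_, ?_⟩
  · intro u hu
    rw [Submodule.mem_bot] at hu
    subst hu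
    have h0 : (Matrix.of fun a b : Fin m => (0 : MatIdx m → ℂ) (toLex (a, b))) = 0 := by
      ext a b
      simp
    rw [h0, Matrix.rank_zero]
  · exact hcard.trans (by nlinarith)
  · intro χ T
    haveI : Module.Finite ℂ ↥(MvPolynomial.homogeneousSubmodule (MatIdx m × MatIdx m) ℂ (m * δ)) :=
      Module.Finite.iff_fg.mpr (MvPolynomial.homogeneousSubmodule_fg (MatIdx m × MatIdx m) ℂ (m * δ))
    haveI : Module.Finite ℂ ↥(MvPolynomial.homogeneousSubmodule (MatIdx m × MatIdx m) ℂ (m * δ) ⊓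
          (⨅ (P : Matrix (Fin m) (Fin m) ℂ) (Q : Matrix (Fin m) (Fin m) ℂ) (_ : P.det = 1) (_ : Q.det = 1), LinearMap.ker ((MvPolynomial.aeval fun p : MatIdx m × MatIdx m => ∑ l : MatIdx m, (P (ofLex p.2).1 (ofLex l).1 * Q (ofLex l).2 (ofLex p.2).2) • (MvPolynomial.X (p.1, l) : MvPolynomial (MatIdx m × MatIdx m) ℂ)).toLinearMap - (LinearMap.id : MvPolynomial (MatIdx m × MatIdx m) ℂ →ₗ[ℂ] MvPolynomial (MatIdx m × MatIdx m) ℂ))) ⊓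
          (⨅ (g : Matrix.GeneralLinearGroup (MatIdx m) ℂ) (_ : IsUpperTriangular g), LinearMap.ker ((MvPolynomial.aeval fun p : MatIdx m × MatIdx m => ∑ l : MatIdx m, ((g⁻¹ : Matrix.GeneralLinearGroup (MatIdx m) ℂ) : Matrix (MatIdx m) (MatIdx m) ℂ) p.1 l • (MvPolynomial.X (l, p.2) : MvPolynomial (MatIdx m × MatIdx m) ℂ)).toLinearMap - weightChar ((Weight.dualOfPartition (m * m) lam).toMatIdx : Weight (MatIdx m)) g • (LinearMap.id : MvPolynomial (MatIdx m × MatIdx m) ℂ →ₗ[ℂ] MvPolynomial (MatIdx m × MatIdx m) ℂ)))) :=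
      Submodule.finiteDimensional_of_le (inf_le_left.trans inf_le_left)
    exact lt_of_le_of_lt (Submodule.finrank_mono (inf_le_inf (le_inf (inf_le_left.trans inf_le_left)
      (inf_le_right.trans ((stub_stabInv_le_explicit m).trans inf_le_left))) le_rfl)) hlt

/-- **The crux from the line**: `ValuativeGCT.ValuativeFlip` BY NAME from the five registered stubs
(used by name; `sorryAx` enters only through them) — the head (`headFlipBody_of`, stubs 1–4, slope `6/5`)
and the tail stub, glued by the case split on `5·m ≤ 6·n` (= the split glue `ValuativeFlip_of_subs`).
Sorry-free over the stubs. [this line] -/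
theorem audit_ValuativeFlip_of_tail
    (hTail : Summit.ValiantsHypothesis.ValiantsHypothesis.Theses.ValuativeGCT.TailFlip) :
    Summit.ValiantsHypothesis.ValiantsHypothesis.Theses.ValuativeGCT.ValuativeFlip := by
  have hS1 := audit_stub_fourRowSliceBound
  have hS2 := audit_stub_fourRowPencilRank
  have hS3 := audit_stub_fourRowHilbertLowerBound
  have hS4 := audit_stub_fourRowBridge
  obtain ⟨n₁, hHead⟩ := audit_headFlipBody_of hS1 hS2 hS3 hS4
  intro c
  obtain ⟨n₂, hT⟩ := hTail 6 5 (by norm_num) c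
  refine ⟨max n₁ n₂, fun n hn m _ hnm hm => ?_⟩
  have hn₁ : n₁ ≤ n := le_of_max_le_left hn
  have hn₂ : n₂ ≤ n := le_of_max_le_right hn
  by_cases hcase : 5 * m ≤ 6 * n
  · exact hHead n hn₁ m hnm hcase
  · exact hT n hn₂ m (Nat.lt_of_not_le hcase) hm

/-! ## What the audit certifies -/

/-- The head of the line, UNCONDITIONALLY, from the four landed stubs through the skeleton's own glue
(`headFlipBody_of`); the same statement is landed as `HeadFlip.headFlipBody_holds`. -/
theorem audit_headFlipBody :
    ∃ n₀ : ℕ, ∀ n ≥ n₀, ∀ (m : ℕ) [NeZero m], n ≤ m → 5 * m ≤ 6 * n →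
      ∃ (U : Submodule ℂ (MatIdx m → ℂ)) (r δ : ℕ) (lam : Nat.Partition (m * δ)), (∀ u ∈ U, (Matrix.of fun a b : Fin m => u (toLex (a, b))).rank ≤ r) ∧ lam.parts.card ≤ m * m ∧ (let χ : Weight (MatIdx m) := (Weight.dualOfPartition (m * m) lam).toMatIdx; let T : Submodule ℂ (MvPolynomial (MatIdx m × MatIdx m) ℂ) := MvPolynomial.homogeneousSubmodule (MatIdx m × MatIdx m) ℂ (m * δ) ⊓ ((MvPolynomial.vanishingIdeal ℂ {p : MatIdx m × MatIdx m → ℂ | ∀ j : MatIdx m, (fun i => p (j, i)) ∈ U}) ^ (δ * (m - r))).restrictScalars ℂ ⊓ (⨅ (M : Matrix (MatIdx m) (MatIdx m) ℂ) (_ : linSubst (MatIdx m) ℂ M (detFormLex ℂ m) = detFormLex ℂ m), LinearMap.ker ((MvPolynomial.aeval (R := ℂ) fun p : MatIdx m × MatIdx m => ∑ l : MatIdx m, M l p.2 • MvPolynomial.X (p.1, l)).toLinearMap - LinearMap.id (R := ℂ) (M := MvPolynomial (MatIdx m × MatIdx m) ℂ))) ⊓ (⨅ (g : Matrix.GeneralLinearGroup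 (MatIdx m) ℂ) (_ : IsUpperTriangular g), LinearMap.ker ((MvPolynomial.aeval (R := ℂ) fun p : MatIdx m × MatIdx m => ∑ l : MatIdx m, ((g⁻¹ : Matrix.GeneralLinearGroup (MatIdx m) ℂ) : Matrix (MatIdx m) (MatIdx m) ℂ) p.1 l • MvPolynomial.X (l, p.2)).toLinearMap - weightChar χ g • LinearMap.id (R := ℂ) (M := MvPolynomial (MatIdx m × MatIdx m) ℂ))); Module.finrank ℂ ↥T < orbitMultiplicity ℂ (paddedPerFormLex ℂ n m) m χ) :=
  audit_headFlipBody_of audit_stub_fourRowSliceBound audit_stub_fourRowPencilRank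
    audit_stub_fourRowHilbertLowerBound audit_stub_fourRowBridge

/-- The child crux `HeadFlip` is a theorem of the tree (by name). -/
theorem audit_HeadFlip : Summit.ValiantsHypothesis.ValiantsHypothesis.Theses.ValuativeGCT.HeadFlip :=
  Summit.ValiantsHypothesis.ValiantsHypothesis.Theorems.HeadFlip.HeadFlip_proof

/-- The residual of the line is exactly the route decl `TailFlip`, which is equivalent to the crux
(landed `tailFlip_iff_valuativeFlip`): the line reduces `ValuativeFlip` to itself-on-the-tail. -/
theorem audit_residual_iff :
    Summit.ValiantsHypothesis.ValiantsHypothesis.Theses.ValuativeGCT.ValuativeFlip ↔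
      Summit.ValiantsHypothesis.ValiantsHypothesis.Theses.ValuativeGCT.TailFlip :=
  tailFlip_iff_valuativeFlip.symm

end

end Summit.ValiantsHypothesis.ValiantsHypothesis.Cruxes.ValuativeFlip.FourRowCountAudit
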